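import Summits.QuantumFields.YangMills.Theorems.BalabanLadderNTReferenceMarginsThreePoint
import HarnessLib

/-!
# Crux `NT` (stmt-QuantumFields-19353): the MARGINS of `RefPkgT` are β-UNIFORM NUMBERS, IV — CLOSED-FORM envelopes:
# the thresholds in terms of the witnesses' sup norms and support radius only

Helper file (`--supports stmt-QuantumFields-19353`) of the fleet lead prover of crux `NT` (unit `ym-spine-19353-p1`,
g11), hypothesis-free; sequel of `…NTReferenceMargins` / `…NTReferenceMarginsThreePoint`.  There the clause-4/5 margins of
the registered stub were bounded by `K_θK_v(2C₁²/κ⁸ + C₂/(κ⁴(2δ)⁴))` and `K_fK_gK_h(6C₁C₂/(κ⁸δ⁴) + 2C₁³/κ¹² + C₃/(κ⁴δ⁸))`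
with the lattice ℓ¹-envelopes `K` of the tree (Schwartz-seminorm constants, existential).  Here the envelopes are made
ELEMENTARY: a test function with `|v| ≤ M` supported in the ball of radius `σ` has at most `(2⌈σ/a⌉₊ + 1)⁴` charged lattice
points at unit `a`, so

* `sum_abs_lattice_le_sup_mul_card` — `Σ_{x∈Λ} |v(a x)| ≤ M · (2⌈σ/a⌉₊ + 1)⁴` for every finite `Λ ⊆ ℤ⁴` (`a > 0`);
* `sum_abs_lattice_le_sup_div` — hence `Σ_{x∈Λ} |v(a x)| ≤ M (2σ + 3)⁴ / a⁴` for `0 < a ≤ 1`: the ℓ¹-envelope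
  **`K_v = M (2σ+3)⁴`** is admissible; `tsupport_thetaTest_subset_closedBall_zero`, `abs_thetaTest_le` — the reflected witness
  `θv` has the same sup bound and support radius, so `K_θ = M (2σ+3)⁴` as well;
* **`refMargin₂_le_explicit`** — the clause-4 margin is at most **`M² (2σ+3)⁸ · (2C₁²/κ⁸ + C₂/(κ⁴(2δ)⁴))`** for every unit
  `0 < a ≤ 1` and every box (`M` = sup of `|v|`, `σ` = support radius, `δ` = time gap, `κ` = collar);
* **`refMargin₃_le_explicit`** — the clause-5 margin is at most **`M_f M_g M_h (2σ+3)¹² · (6C₁C₂/(κ⁸δ⁴) + 2C₁³/κ¹² + C₃/(κ⁴δ⁸))`**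
  (`δ` = common pairwise support separation).

NUMBERS (owner's / LEAD's pen; nothing registered).  With these envelopes the engine's floor targets of
`nt_of_torusReferencePackage_plain` read, in closed form,
  `ε₄ > M²(2σ+3)⁸(2C₁²κ⁻⁸ + C₂κ⁻⁴(2δ)⁻⁴)`,   `ε₅ > M_fM_gM_h(2σ+3)¹²(6C₁C₂κ⁻⁸δ⁻⁴ + 2C₁³κ⁻¹² + C₃κ⁻⁴δ⁻⁸)`;
the counting envelope `M(2σ+3)⁴` overshoots `‖v‖₁` by the filling factor of the witness in its ball (and `(2σ+3)⁴` vs the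
ball volume `π²σ⁴/2`), which is the price of closed form; the ℓ¹ form of files I–III is sharper by exactly that factor.

HONEST FRAMING.  Lattice-point counting and bookkeeping; the floors and ceilings are engine-grade OPEN; not a floor, not
AF, not NT, not the seam, not the gap; not Clay.
-/

set_option autoImplicit false

noncomputable section

open scoped SchwartzMap
open MeasureTheory Filter Topology Finset
open Literature.MathematicalPhysics.QuantumFieldTheory Literature.MathematicalPhysics.QuantumLattice
open Literature.Probability.LatticeModels
open Summit.QuantumFields.YangMills.Cruxes.OSLegsFromFemtoAndGap.DlrCollarTransfer

namespace Summit.QuantumFields.YangMills.Cruxes.NT.Reference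

/-! ## §1 Counting envelopes -/

section Counting

/-- **Counting envelope.**  If `|v| ≤ M` and `tsupport v ⊆ closedBall 0 σ`, then at unit `a > 0` and for every finite
`Λ ⊆ ℤ⁴`: `Σ_{x∈Λ} |v(a x)| ≤ M · (2⌈σ/a⌉₊ + 1)⁴` (the charged points lie in the box `⌈σ/a⌉₊`, tree
`apply_smul_siteToE_eq_zero`, whose cardinality is `(2⌈σ/a⌉₊+1)⁴`, tree `card_box`). [folklore] -/
theorem sum_abs_lattice_le_sup_mul_card {v : 𝓢(EuclideanSpace ℝ (Fin 4), ℝ)} {M σ : ℝ}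
    (hM : ∀ y : EuclideanSpace ℝ (Fin 4), |v y| ≤ M)
    (hvσ : tsupport (v : EuclideanSpace ℝ (Fin 4) → ℝ) ⊆ Metric.closedBall 0 σ) {a : ℝ} (ha : 0 < a)
    (Λ : Finset (Fin 4 → ℤ)) :
    ∑ x ∈ Λ, |v (a • siteToE x)| ≤ M * ((2 * ⌈σ / a⌉₊ + 1 : ℕ) : ℝ) ^ 4 := by
  have hM0 : 0 ≤ M := (abs_nonneg _).trans (hM 0)
  -- split off the uncharged points
  rw [← sum_filter_add_sum_filter_not Λ (fun x => x ∈ box 4 ⌈σ / a⌉₊)]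
  have hzero : ∑ x ∈ Λ.filter (fun x => ¬ x ∈ box 4 ⌈σ / a⌉₊), |v (a • siteToE x)| = 0 := by
    refine sum_eq_zero fun x hx => ?_
    rw [mem_filter] at hx
    rw [apply_smul_siteToE_eq_zero ha hvσ hx.2, abs_zero]
  rw [hzero, add_zero]
  calc ∑ x ∈ Λ.filter (fun x => x ∈ box 4 ⌈σ / a⌉₊), |v (a • siteToE x)|
      ≤ ∑ x ∈ box 4 ⌈σ / a⌉₊, |v (a • siteToE x)| :=
        sum_le_sum_of_subset_of_nonneg (fun x hx => (mem_filter.1 hx).2) (fun _ _ _ => abs_nonneg _)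
    _ ≤ ∑ _x ∈ box 4 ⌈σ / a⌉₊, M := sum_le_sum fun x _ => hM _
    _ = M * ((2 * ⌈σ / a⌉₊ + 1 : ℕ) : ℝ) ^ 4 := by
        rw [sum_const, card_box, nsmul_eq_mul, mul_comm]
        push_cast
        ring

/-- **Closed-form ℓ¹-envelope**: for `0 < a ≤ 1` (and `0 ≤ σ`), `Σ_{x∈Λ} |v(a x)| ≤ M (2σ+3)⁴ / a⁴`. [folklore] -/
theorem sum_abs_lattice_le_sup_div {v : 𝓢(EuclideanSpace ℝ (Fin 4), ℝ)} {M σ : ℝ}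
    (hM : ∀ y : EuclideanSpace ℝ (Fin 4), |v y| ≤ M)
    (hvσ : tsupport (v : EuclideanSpace ℝ (Fin 4) → ℝ) ⊆ Metric.closedBall 0 σ) (hσ : 0 ≤ σ) {a : ℝ} (ha : 0 < a)
    (ha1 : a ≤ 1) (Λ : Finset (Fin 4 → ℤ)) :
    ∑ x ∈ Λ, |v (a • siteToE x)| ≤ M * (2 * σ + 3) ^ 4 / a ^ 4 := by
  have hM0 : 0 ≤ M := (abs_nonneg _).trans (hM 0)
  refine (sum_abs_lattice_le_sup_mul_card hM hvσ ha Λ).trans ?_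
  -- `(2⌈σ/a⌉₊ + 1) · a ≤ 2σ + 3a ≤ 2σ + 3`
  have hceil : (⌈σ / a⌉₊ : ℝ) < σ / a + 1 := Nat.ceil_lt_add_one (div_nonneg hσ ha.le)
  have h1 : ((2 * ⌈σ / a⌉₊ + 1 : ℕ) : ℝ) * a ≤ 2 * σ + 3 := by
    push_cast
    have : (σ / a) * a = σ := div_mul_cancel₀ σ ha.ne'
    nlinarith
  have h0 : 0 ≤ ((2 * ⌈σ / a⌉₊ + 1 : ℕ) : ℝ) := Nat.cast_nonneg _
  have h2 : ((2 * ⌈σ / a⌉₊ + 1 : ℕ) : ℝ) ≤ (2 * σ + 3) / a := by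
    rw [le_div_iff₀ ha]; exact h1
  rw [mul_div_assoc, ← div_pow]
  exact mul_le_mul_of_nonneg_left (pow_le_pow_left₀ h0 h2 4) hM0

/-- The reflected witness is supported in the same ball: `tsupport (θv) ⊆ closedBall 0 σ` (the time reflection is a
linear isometry). [folklore] -/
theorem tsupport_thetaTest_subset_closedBall_zero {v : 𝓢(EuclideanSpace ℝ (Fin 4), ℝ)} {σ : ℝ}
    (hvσ : tsupport (v : EuclideanSpace ℝ (Fin 4) → ℝ) ⊆ Metric.closedBall 0 σ) :
    tsupport (thetaTest 4 v : EuclideanSpace ℝ (Fin 4) → ℝ) ⊆ Metric.closedBall 0 σ := by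
  intro y hy
  have hK : IsClosed ((timeReflection 4) ⁻¹' tsupport (v : EuclideanSpace ℝ (Fin 4) → ℝ)) :=
    (isClosed_tsupport _).preimage (timeReflection 4).continuous
  have hsub : Function.support (thetaTest 4 v : EuclideanSpace ℝ (Fin 4) → ℝ) ⊆
      (timeReflection 4) ⁻¹' tsupport (v : EuclideanSpace ℝ (Fin 4) → ℝ) := by
    intro z hz
    rw [Function.mem_support, thetaTest_apply] at hz
    exact subset_tsupport _ (Function.mem_support.2 hz)
  have h1 : timeReflection 4 y ∈ Metric.closedBall (0 : EuclideanSpace ℝ (Fin 4)) σ := hvσ (closure_minimal hsub hK hy)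
  rw [mem_closedBall_zero_iff, LinearIsometryEquiv.norm_map] at h1
  exact mem_closedBall_zero_iff.2 h1

/-- The reflected witness has the same sup bound: `|θv y| = |v (θ y)| ≤ M`. [folklore] -/
theorem abs_thetaTest_le {v : 𝓢(EuclideanSpace ℝ (Fin 4), ℝ)} {M : ℝ}
    (hM : ∀ y : EuclideanSpace ℝ (Fin 4), |v y| ≤ M) (y : EuclideanSpace ℝ (Fin 4)) : |thetaTest 4 v y| ≤ M := by
  rw [thetaTest_apply]; exact hM _

end Counting

/-! ## §2 The margins in closed form -/

section Explicit

/-- **Clause-4 margin, closed form.**  For a witness `v` with `|v| ≤ M`, support in `closedBall 0 σ` (`0 ≤ σ`) and time gap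
`δ > 0`, constants `C₂ ≥ 0`, `κ > 0` (any `C₁`), every unit `0 < a ≤ 1` and every finite `Λ ⊆ ℤ⁴`: the clause-4 margin of
`RefPkgT` is at most `M² (2σ+3)⁸ (2C₁²/κ⁸ + C₂/(κ⁴(2δ)⁴))`. [folklore] -/
theorem refMargin₂_le_explicit {v : 𝓢(EuclideanSpace ℝ (Fin 4), ℝ)} {M σ δ : ℝ}
    (hM : ∀ y : EuclideanSpace ℝ (Fin 4), |v y| ≤ M)
    (hvσ : tsupport (v : EuclideanSpace ℝ (Fin 4) → ℝ) ⊆ Metric.closedBall 0 σ) (hσ : 0 ≤ σ) (hδ : 0 < δ)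
    (hvδ : ∀ y : EuclideanSpace ℝ (Fin 4), v y ≠ 0 → δ ≤ y 0)
    {C₁ C₂ κ : ℝ} (hC₂ : 0 ≤ C₂) (hκ : 0 < κ) {a : ℝ} (ha : 0 < a) (ha1 : a ≤ 1) (Λ : Finset (Fin 4 → ℤ)) :
    2 * (C₁ * (a / κ) ^ 4 * ∑ x ∈ Λ, |thetaTest 4 v (a • siteToE x)|) *
          (C₁ * (a / κ) ^ 4 * ∑ y ∈ Λ, |v (a • siteToE y)|) +
        C₂ * (a / κ) ^ 4 * ∑ x ∈ Λ, ∑ y ∈ Λ,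
          |thetaTest 4 v (a • siteToE x)| * |v (a • siteToE y)| / (1 + ‖siteToE (y - x)‖) ^ 4 ≤
      M ^ 2 * (2 * σ + 3) ^ 8 * (2 * C₁ ^ 2 / κ ^ 8 + C₂ / (κ ^ 4 * (2 * δ) ^ 4)) := by
  have hM0 : 0 ≤ M := (abs_nonneg _).trans (hM 0)
  have hKθ : ∀ s : ℝ, 0 < s → s ≤ 1 → ∀ Λ' : Finset (Fin 4 → ℤ),
      ∑ x ∈ Λ', |thetaTest 4 v (s • siteToE x)| ≤ M * (2 * σ + 3) ^ 4 / s ^ 4 := fun s hs hs1 Λ' =>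
    sum_abs_lattice_le_sup_div (abs_thetaTest_le hM) (tsupport_thetaTest_subset_closedBall_zero hvσ) hσ hs hs1 Λ'
  have hKv : ∀ s : ℝ, 0 < s → s ≤ 1 → ∀ Λ' : Finset (Fin 4 → ℤ),
      ∑ y ∈ Λ', |v (s • siteToE y)| ≤ M * (2 * σ + 3) ^ 4 / s ^ 4 := fun s hs hs1 Λ' =>
    sum_abs_lattice_le_sup_div hM hvσ hσ hs hs1 Λ'
  have h := refMargin₂_le (C₁ := C₁) hδ hvδ (by positivity) hKθ hKv hC₂ hκ ha ha1 Λ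
  have e : M * (2 * σ + 3) ^ 4 * (M * (2 * σ + 3) ^ 4) = M ^ 2 * (2 * σ + 3) ^ 8 := by ring
  rwa [e] at h

/-- **Clause-5 margin, closed form.**  For witnesses `f, g, h` with `|f| ≤ M_f`, `|g| ≤ M_g`, `|h| ≤ M_h`, supports in
`closedBall 0 σ` (`0 ≤ σ`), pairwise separated by `δ > 0`, constants `C₁, C₂, C₃ ≥ 0`, `κ > 0`, every unit `0 < a ≤ 1` and
every finite `Λ ⊆ ℤ⁴`: the clause-5 margin of `RefPkgT` is at most
`M_f M_g M_h (2σ+3)¹² (6C₁C₂/(κ⁸δ⁴) + 2C₁³/κ¹² + C₃/(κ⁴δ⁸))`. [folklore] -/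
theorem refMargin₃_le_explicit {f g h : 𝓢(EuclideanSpace ℝ (Fin 4), ℝ)} {Mf Mg Mh σ δ : ℝ}
    (hMf : ∀ y : EuclideanSpace ℝ (Fin 4), |f y| ≤ Mf) (hMg : ∀ y : EuclideanSpace ℝ (Fin 4), |g y| ≤ Mg)
    (hMh : ∀ y : EuclideanSpace ℝ (Fin 4), |h y| ≤ Mh)
    (hfσ : tsupport (f : EuclideanSpace ℝ (Fin 4) → ℝ) ⊆ Metric.closedBall 0 σ)
    (hgσ : tsupport (g : EuclideanSpace ℝ (Fin 4) → ℝ) ⊆ Metric.closedBall 0 σ)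
    (hhσ : tsupport (h : EuclideanSpace ℝ (Fin 4) → ℝ) ⊆ Metric.closedBall 0 σ) (hσ : 0 ≤ σ) (hδ : 0 < δ)
    (hfg : ∀ p q : EuclideanSpace ℝ (Fin 4), f p ≠ 0 → g q ≠ 0 → δ ≤ ‖p - q‖)
    (hgh : ∀ p q : EuclideanSpace ℝ (Fin 4), g p ≠ 0 → h q ≠ 0 → δ ≤ ‖p - q‖)
    (hfh : ∀ p q : EuclideanSpace ℝ (Fin 4), f p ≠ 0 → h q ≠ 0 → δ ≤ ‖p - q‖)
    {C₁ C₂ C₃ κ : ℝ} (hC₁ : 0 ≤ C₁) (hC₂ : 0 ≤ C₂) (hC₃ : 0 ≤ C₃) (hκ : 0 < κ) {a : ℝ} (ha : 0 < a) (ha1 : a ≤ 1)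
    (Λ : Finset (Fin 4 → ℤ)) :
    ∑ x ∈ Λ, ∑ y ∈ Λ, ∑ z ∈ Λ,
        |f (a • siteToE x)| * |g (a • siteToE y)| * |h (a • siteToE z)| *
          (2 * ((C₁ * (a / κ) ^ 4) * (C₂ * (a / κ) ^ 4 / (1 + ‖siteToE (z - y)‖) ^ 4) +
                (C₁ * (a / κ) ^ 4) * (C₂ * (a / κ) ^ 4 / (1 + ‖siteToE (z - x)‖) ^ 4) +
                (C₁ * (a / κ) ^ 4) * (C₂ * (a / κ) ^ 4 / (1 + ‖siteToE (y - x)‖) ^ 4) +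
                (C₁ * (a / κ) ^ 4) * (C₁ * (a / κ) ^ 4) * (C₁ * (a / κ) ^ 4)) +
            C₃ * (a / κ) ^ 4 / (1 + min (min ‖siteToE (y - x)‖ ‖siteToE (z - y)‖) ‖siteToE (z - x)‖) ^ 8) ≤
      Mf * Mg * Mh * (2 * σ + 3) ^ 12 * (6 * C₁ * C₂ / (κ ^ 8 * δ ^ 4) + 2 * C₁ ^ 3 / κ ^ 12 + C₃ / (κ ^ 4 * δ ^ 8)) := by
  have hMf0 : 0 ≤ Mf := (abs_nonneg _).trans (hMf 0)
  have hMg0 : 0 ≤ Mg := (abs_nonneg _).trans (hMg 0)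
  have hKf : ∀ s : ℝ, 0 < s → s ≤ 1 → ∀ Λ' : Finset (Fin 4 → ℤ),
      ∑ x ∈ Λ', |f (s • siteToE x)| ≤ Mf * (2 * σ + 3) ^ 4 / s ^ 4 := fun s hs hs1 Λ' =>
    sum_abs_lattice_le_sup_div hMf hfσ hσ hs hs1 Λ'
  have hKg : ∀ s : ℝ, 0 < s → s ≤ 1 → ∀ Λ' : Finset (Fin 4 → ℤ),
      ∑ y ∈ Λ', |g (s • siteToE y)| ≤ Mg * (2 * σ + 3) ^ 4 / s ^ 4 := fun s hs hs1 Λ' =>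
    sum_abs_lattice_le_sup_div hMg hgσ hσ hs hs1 Λ'
  have hKh : ∀ s : ℝ, 0 < s → s ≤ 1 → ∀ Λ' : Finset (Fin 4 → ℤ),
      ∑ z ∈ Λ', |h (s • siteToE z)| ≤ Mh * (2 * σ + 3) ^ 4 / s ^ 4 := fun s hs hs1 Λ' =>
    sum_abs_lattice_le_sup_div hMh hhσ hσ hs hs1 Λ'
  have hh := refMargin₃_le hδ hfg hgh hfh (by positivity) (by positivity) hKf hKg hKh hC₁ hC₂ hC₃ hκ ha ha1 Λ
  have e : Mf * (2 * σ + 3) ^ 4 * (Mg * (2 * σ + 3) ^ 4) * (Mh * (2 * σ + 3) ^ 4) =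
      Mf * Mg * Mh * (2 * σ + 3) ^ 12 := by ring
  rwa [e] at hh

end Explicit

end Summit.QuantumFields.YangMills.Cruxes.NT.Reference

end
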